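import Summits.BirchSwinnertonDyer.BirchSwinnertonDyer.Theorems.SchneiderFreeAdditiveX3PoitouTatePresentationRoad
import Literature.NumberTheory.GaloisRepresentations.IdeleClassBarTateDualityHypotheses
import HarnessLib

/-!
# Poitou–Tate toolkit: the presentation road with Tate's `α¹`-injectivity DISCHARGED — `Ker γ¹ ⊆ Im β¹` over all
# places from a presentation with FINITE `N` and a readout (R1)–(R4) alone (Milne ADT I Thm. 1.8 (b) + Thm. 4.10)

Cell `bsd-schneider-ideate`, seat `bsd-schneider-door-c4` (prover, generation 17).  PARTITION: board row B6 ∩ X3 ∩ sst-twist,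
`r = 1`, of `Rank1Residual.partition` — CONTROL corner (crux `AnticycControlAdditiveK`, stmt-BirchSwinnertonDyer-19295; facts
binder `ControlFacts` (i), stmt-19538); types-the-object-of the hypothesis `hα` of door-c6 g16's F8 skeleton
`middleExact_allPlaces_of_readout` (this directory, `…PoitouTatePresentationRoad`): by door-c4 g15–g17 / door-c5 / door-c6's
class field theory chain, **the hypotheses of Tate's duality theorem hold for the idèle class formation**
(`IdeleClassBar.tateDualityHypotheses_classBarD_classBarInvD`), so `α¹(Γ_K, N) : Ext¹_{C_Γ}(N, C̄) → Hom(Ext¹(ℤ, N), ℚ/ℤ)` is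
injective for every FINITE discrete `N` (`IdeleClassBar.adjointInjective_one_classBarInv'`, Milne ADT I Thm. 1.8 (b)) and `hα`
disappears from the skeleton whenever `S.X₃` is finite (it is: `N = M₀` or `M₀^D`).  THEOREMS ONLY; closes nothing by itself
(BSD is not advanced; what remains for hE is the idèle readout (R-def)/(R3)/(R4), see HOME memos/FINDING-door-c6-g16.md §5 and
memos/FINDING-door-c4-g17.md §4).

* **`middleExact_allPlaces_of_readout_of_finite`** — `middleExact_allPlaces_of_readout` with `[Finite S.X₃.obj.V]` in place of `hα`.

References: [MilneADT2006] I Thm. 1.8 (b), Lemma 4.13, Thm. 4.10 (b) and its proof (p. 58); [Harari2020] §16.3 Thm. 16.21, §17.3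
Thm. 17.13; [Tate1963DualityICM].
-/

noncomputable section

open Function NumberField IsDedekindDomain CategoryTheory CategoryTheory.Abelian
open scoped NumberField

set_option linter.dupNamespace false
set_option autoImplicit false

namespace Summit.BirchSwinnertonDyer.BirchSwinnertonDyer.Theorems.SchneiderFreeAdditiveX3.PoitouTateReduction

open Field
open Literature.NumberTheory.GaloisRepresentations Literature.NumberTheory.GaloisCohomology
open Literature.NumberTheory.GaloisRepresentations.DiscreteGaloisModule (mu TateDual tateDual
  localTatePairingZMod unramifiedSubgroup)
open Literature.Algebra.Homology Literature.Algebra.Homology.DiscreteRep Literature.Algebra.Homology.ExtPresentation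
open Literature.NumberTheory.GaloisRepresentations.IdeleClassBar (classBarInv classBarD)

section Readout

variable {K : Type} [Field K] [NumberField K] {n : ℕ} [NeZero n]
variable {M : Type} [AddCommGroup M] [TopologicalSpace M] [DiscreteTopology M] [Finite M]

/-- **Milne I Thm. 4.10(b), `r = 1`, `Ker γ¹ ⊆ Im β¹` over ALL places, from a presentation of a FINITE `N = S.X₃` and a
readout of `Hom_{C_Γ}(N₁, J̄)` with properties (R1)–(R4)** — door-c6 g16's `middleExact_allPlaces_of_readout` with its
hypothesis `hα` (Tate's `α¹`-injectivity for `C̄`) DISCHARGED by `IdeleClassBar.adjointInjective_one_classBarInv'`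
(Tate duality for the idèle class formation, door-c4 g17).  The conclusion is, verbatim, the body of the hypothesis `hA` of
`poitouTate_selmerStructure_duality_of_allPlaces_canonical` at `(n, ρ)`.
[cite: MilneADT2006, Ch. I, Thm. 1.8 (b), Lemma 4.13 and Thm. 4.10(b) (proof, p. 58)][cite: Harari2020, §17.3, Thm. 17.13] -/
theorem middleExact_allPlaces_of_readout_of_finite (ρ : DiscreteGaloisModule K M)
    {S : ShortComplex (DiscreteRepCat ℤ (absoluteGaloisGroup K))} (hS : S.ShortExact) [Finite S.X₃.obj.V]
    (hP : ∀ x : Abelian.Ext S.X₂ (ideleClassLimitShortComplex K).X₁ 1, x = 0)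
    (R : ∀ v : Place K, (S.X₁ ⟶ (ideleClassLimitShortComplex K).X₂) →+ galoisCohomology (ρ.toLocal v) 1)
    (hR1 : ∀ (q : S.X₂ ⟶ (ideleClassLimitShortComplex K).X₂) (v : Place K), R v (S.f ≫ q) = 0)
    (hR2 : ∀ h : S.X₁ ⟶ (ideleClassLimitShortComplex K).X₁, ∃ x : galoisCohomology ρ 1,
      ∀ v : Place K, R v (h ≫ (ideleClassLimitShortComplex K).f) = galoisCohomology.localization ρ v 1 x)
    (hR3 : ∀ T : Finset (Place K), (∀ w : InfinitePlace K, (Sum.inl w : Place K) ∈ T) →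
      (∀ v : HeightOneSpectrum (𝓞 K), (Sum.inr v : Place K) ∉ T →
        ((n : ℕ) : 𝓞 K) ∉ v.asIdeal ∧ GaloisRep.IsUnramifiedAt v ρ) →
      ∀ t : Π v : Place K, galoisCohomology (ρ.toLocal v) 1,
        (∀ v : HeightOneSpectrum (𝓞 K), (Sum.inr v : Place K) ∉ T →
          t (Sum.inr v) ∈ unramifiedSubgroup (GaloisRep.toLocal v ρ) 1) →
        ∃ f : S.X₁ ⟶ (ideleClassLimitShortComplex K).X₂, ∀ v : Place K, R v f = t v)
    (hR4 : ∀ (f : S.X₁ ⟶ (ideleClassLimitShortComplex K).X₂)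
      (ŷ : Abelian.Ext (triv (Γ := absoluteGaloisGroup K) ℤ) S.X₃ 1) (T₀ : Finset (Place K)),
      ∃ (y : galoisCohomology (ρ.tateDual n) 1) (Ty : Finset (Place K)), T₀ ⊆ Ty ∧
        (∀ v : HeightOneSpectrum (𝓞 K), (Sum.inr v : Place K) ∉ Ty →
          galoisCohomology.localization (ρ.tateDual n) (Sum.inr v) 1 y ∈
            unramifiedSubgroup (GaloisRep.toLocal v (ρ.tateDual n)) 1) ∧
        ((∀ T' : Finset (Place K), Ty ⊆ T' →
            ∑ v ∈ T', localTatePairingZMod ρ n v (LocalInvariants.canonical K n v) (R v f)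
              (galoisCohomology.localization (ρ.tateDual n) v 1 y) = 0) →
          classBarInv K (ŷ.comp (boundary hS (classBarD K) (f ≫ (ideleClassLimitShortComplex K).g))
            (rfl : 1 + 1 = 2)) = 0)) :
    ∀ T : Finset (Place K), (∀ w : InfinitePlace K, (Sum.inl w : Place K) ∈ T) →
      (∀ v : HeightOneSpectrum (𝓞 K), (Sum.inr v : Place K) ∉ T →
        ((n : ℕ) : 𝓞 K) ∉ v.asIdeal ∧ GaloisRep.IsUnramifiedAt v ρ) →
      ∀ t : Π v : Place K, galoisCohomology (ρ.toLocal v) 1,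
        (∀ v : HeightOneSpectrum (𝓞 K), (Sum.inr v : Place K) ∉ T →
          t (Sum.inr v) ∈ unramifiedSubgroup (GaloisRep.toLocal v ρ) 1) →
        (∀ (y : galoisCohomology (ρ.tateDual n) 1) (T' : Finset (Place K)), T ⊆ T' →
          (∀ v : HeightOneSpectrum (𝓞 K), (Sum.inr v : Place K) ∉ T' →
            galoisCohomology.localization (ρ.tateDual n) (Sum.inr v) 1 y ∈
              unramifiedSubgroup (GaloisRep.toLocal v (ρ.tateDual n)) 1) →
          ∑ v ∈ T', localTatePairingZMod ρ n v (LocalInvariants.canonical K n v) (t v)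
            (galoisCohomology.localization (ρ.tateDual n) v 1 y) = 0) →
        ∃ x : galoisCohomology ρ 1, ∀ v : Place K, galoisCohomology.localization ρ v 1 x = t v :=
  middleExact_allPlaces_of_readout ρ hS hP (IdeleClassBar.adjointInjective_one_classBarInv' K S.X₃) R hR1 hR2 hR3 hR4

end Readout

end Summit.BirchSwinnertonDyer.BirchSwinnertonDyer.Theorems.SchneiderFreeAdditiveX3.PoitouTateReduction

end
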